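/-
Copyright: H21 K2-LIT squad (hodgecm-mathlib). Helper for crux hLiu418 = `stmt-HodgeConjecture-24832`
(route `route-HodgeConjecture-HCCMUnconditional`), G-road arch debt «(D-ht)» (LEAD ruling «M-156h», G2-PS-B, file B3a).
-/
import Summits.HodgeConjecture.HodgeConjecture.Theorems.K2LiuIwasawaHeightLieDerivativeDefs       -- `gramHeightFun`, `heightDeriv`
import Summits.HodgeConjecture.HodgeConjecture.Theorems.K2LiuIwasawaHeightArchReduction          -- ★ B1
import Mathlib.Analysis.SpecialFunctions.Sqrt
import HarnessLib

/-!
# The Iwasawa height along archimedean orbits as a Gram height function; differentiability (STANDARD data)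

First half (B3a) of the payment of the arch debt «(D-ht)» of SIGS-RoadI-v3 (inputs `hH`, `hHK` of ★ `K2LiuFlatSectionLieDerivative`); the
head `exists_heightDeriv_of_isStd` is in the companion file B3b `K2LiuIwasawaHeightLieDerivative`. This file: steps 1–4 of the route

Route (no Lie theory, no choice of Iwasawa coordinates beyond ★ `IwasawaDatum.kPart`):
1. `iwasawaHeight_mul_archEmb` — `Φ_𝒦(h · (z,1)) = Φ_𝒦 h · Φ_𝒦((c_h z, 1))`, `c_h = (𝒦.kPart h)_∞ ∈ C_∞` (★ B1, generalised to any `z ∈ H_∞`);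
2. `iwasawaHeight_archEmb_expGL_eq` — `Φ_𝒦((c · exp tX, 1)) = gramHeightFun S c (exp(−tX))` (★ B1 `iwasawaHeight_archEmb_sq`: the height of an
   archimedean element is a product of Gram-determinant ratios; `gramHeightFun` extends it to the whole matrix space);
3. `gramHeightFun_mul_right` — `gramHeightFun S (c k) Y = gramHeightFun S c (k Y k⁻¹)` for `S⁻¹ k S` unitary (★ B2 unitary invariance);
4. `differentiableAt_gramHeightFun`, `hasDerivAt_gramHeightFun_exp` — Fréchet differentiability at `1` (★ B2 `contDiff_siegelGram_mul`, positivity)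
   and the chain rule along `t ↦ exp(−tX)`, whose derivative `(D gramHeightFun)(1)(−X)` is LINEAR in `X`;
5. `hasDerivAt_iwasawaHeight_orbit` — `hH` with `H = heightDeriv 𝒦 S X`; `heightDeriv_mul_K` — `H_X(h k') = (D gramHeightFun_{c_h})(1)(−Ad(k'_∞)X)`
   (`k' γ_X(t) k'⁻¹ = (Ad(k'_∞) exp tX, 1)` and uniqueness of derivatives); hence `isKFinite_heightDeriv` — all right `K`-translates of `H_X` lie in
   the complex span of the image of the finite-dimensional real matrix space under the linear map `Z ↦ (h ↦ (D gramHeightFun_{c_h})(1)(Z))`.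

[cite: KudlaRallis1994, §1 (standard sections, `|a(g)|`)] [cite: Weil1964, Chap. I n° 8 (majorants)] [cite: Tan1999, §1 p. 166]
[cite: Knapp2002, 0.§2 Prop. 0.11 (one-parameter subgroups, `Ad`)] [cite: BorelJacquet1979, §4.1]
-/

set_option linter.dupNamespace false -- the mandated namespace repeats `HodgeConjecture.HodgeConjecture`

open Literature.NumberTheory.Automorphic Literature.NumberTheory.Automorphic.UnitaryGroup
open Literature.NumberTheory.GaloisRepresentations
open Literature.NumberTheory.GelbartRogawski1991 Literature.NumberTheory.GelbartRogawski1991.GRConstruction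
open Literature.NumberTheory.K2Lit.SiegelDoubled
-- `Classical` is needed to see the Mathlib normed-space instances on `mixedSpace L` (note H5 of `AdelicGLnGlue`)
open scoped Classical
open scoped Matrix ComplexOrder Matrix.Norms.Operator ContDiff
open NumberField NumberField.mixedEmbedding NumberField.InfinitePlace IsDedekindDomain

set_option backward.isDefEq.respectTransparency false

namespace Summit.HodgeConjecture.HodgeConjecture.Cruxes.HLiu418.K2LiuIwasawaHeightGramFunction

open Summit.HodgeConjecture.HodgeConjecture.Cruxes.HLiu418.K2LiuArchOneParameterOrbitDefs
open Summit.HodgeConjecture.HodgeConjecture.Cruxes.HLiu418.K2LiuSiegelGramDeterminantDefs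
open Summit.HodgeConjecture.HodgeConjecture.Cruxes.HLiu418.K2LiuSiegelGramDeterminant
open Summit.HodgeConjecture.HodgeConjecture.Cruxes.HLiu418.K2LiuIwasawaHeightContinuous
open Summit.HodgeConjecture.HodgeConjecture.Cruxes.HLiu418.K2LiuIwasawaHeightArchReduction
open Summit.HodgeConjecture.HodgeConjecture.Cruxes.HLiu418.K2LiuIwasawaHeightLieDerivativeDefs

variable (L : Type) [Field L] [NumberField L] [IsCMField L]
variable {N M n : ℕ} (e : Fin N × Fin M ≃ Fin n)
  (dV : Fin N → L) (hdV : ∀ i, IsCMField.complexConj L (dV i) = dV i) (hdV0 : ∀ i, dV i ≠ 0)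
  (dW : Fin M → L) (hdW : ∀ i, IsCMField.complexConj L (dW i) = dW i) (hdW0 : ∀ i, dW i ≠ 0)
variable (𝒦 : IwasawaDatum L e dV hdV dW hdW)
variable {X : Matrix (Fin (n + n)) (Fin (n + n)) (mixedSpace L)}
  (hX : X ∈ archSkew (Fp L) L (IsCMField.complexConj L) (n + n) (hermD L e dV hdV dW hdW))

/-! ## 1. Reduction of `Φ_𝒦(h · (z, 1))` and of the archimedean height to `gramHeightFun` -/

section Reduction

include hdV0 hdW0 in
/-- **`Φ_𝒦(h · (z,1)) = Φ_𝒦 h · Φ_𝒦((c_h z, 1))`** for every `z ∈ H_∞`, `c_h = (𝒦.kPart h)_∞` (standard data; as ★ B1 `iwasawaHeight_mul_archExp`).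
[cite: KudlaRallis1994, §1] [cite: Tan1999, §1 p. 166] -/
theorem iwasawaHeight_mul_archEmb (h𝒦 : 𝒦.IsStd) (h : HA L e dV hdV dW hdW)
    (z : arch (Fp L) L (IsCMField.complexConj L) (n + n) (hermD L e dV hdV dW hdW)) :
    modDelta L e dV hdV dW hdW (𝒦.pPart (h * archEmb (Fp L) L (IsCMField.complexConj L) (n + n) (hermD L e dV hdV dW hdW) z)) =
      modDelta L e dV hdV dW hdW (𝒦.pPart h) *
        modDelta L e dV hdV dW hdW (𝒦.pPart (archEmb (Fp L) L (IsCMField.complexConj L) (n + n) (hermD L e dV hdV dW hdW)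
          (archPart (Fp L) L (IsCMField.complexConj L) (n + n) (hermD L e dV hdV dW hdW) (𝒦.kPart h) * z))) := by
  have hz : h * archEmb (Fp L) L (IsCMField.complexConj L) (n + n) (hermD L e dV hdV dW hdW) z =
      𝒦.pPart h *
        archEmb (Fp L) L (IsCMField.complexConj L) (n + n) (hermD L e dV hdV dW hdW)
          (archPart (Fp L) L (IsCMField.complexConj L) (n + n) (hermD L e dV hdV dW hdW) (𝒦.kPart h) * z) *
        finEmb (Fp L) L (IsCMField.complexConj L) (n + n) (hermD L e dV hdV dW hdW)
          (finPart (Fp L) L (IsCMField.complexConj L) (n + n) (hermD L e dV hdV dW hdW) (𝒦.kPart h)) := by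
    conv_lhs => rw [← 𝒦.pPart_mul_kPart h,
      ← archEmb_mul_finEmb (Fp L) L (IsCMField.complexConj L) (n + n) (hermD L e dV hdV dW hdW) (𝒦.kPart h)]
    rw [map_mul, mul_assoc, mul_assoc, mul_assoc, mul_assoc, archEmb_mul_finEmb_comm]
  rw [hz, iwasawaHeight_mul_K L e dV hdV hdV0 dW hdW hdW0 𝒦 _ (finEmb_finPart_mem h𝒦 (𝒦.kPart_mem h)),
    iwasawaHeight_delta_mul L e dV hdV hdV0 dW hdW hdW0 𝒦 (𝒦.pPart_isSiegelDelta h)]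

include hdV0 hdW0 in
/-- `Φ_𝒦((y a, 1)) = Φ_𝒦((y, 1))` when `(a, 1) ∈ K` (right `K`-invariance). [cite: Tan1999, §1 p. 166] -/
theorem iwasawaHeight_archEmb_mul_of_mem {y a : arch (Fp L) L (IsCMField.complexConj L) (n + n) (hermD L e dV hdV dW hdW)}
    (ha : archEmb (Fp L) L (IsCMField.complexConj L) (n + n) (hermD L e dV hdV dW hdW) a ∈ 𝒦.K) :
    modDelta L e dV hdV dW hdW (𝒦.pPart (archEmb (Fp L) L (IsCMField.complexConj L) (n + n) (hermD L e dV hdV dW hdW) (y * a))) =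
      modDelta L e dV hdV dW hdW (𝒦.pPart (archEmb (Fp L) L (IsCMField.complexConj L) (n + n) (hermD L e dV hdV dW hdW) y)) := by
  rw [map_mul]
  exact iwasawaHeight_mul_K L e dV hdV hdV0 dW hdW hdW0 𝒦 _ ha

omit [IsCMField L] in
/-- the `w`-component of `(c · exp tX)⁻¹` is `exp(−tX)_w · c_w⁻¹`. [cite: Knapp2002, 0.§2 Prop. 0.11] -/
theorem coe_inv_map_mul_expGL (c : GL (Fin (n + n)) (mixedSpace L)) (Z : Matrix (Fin (n + n)) (Fin (n + n)) (mixedSpace L))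
    (w : {w : InfinitePlace L // w.IsComplex}) :
    (((Matrix.GeneralLinearGroup.map (evalC L w) (c * expGL Z))⁻¹ : GL (Fin (n + n)) ℂ) : Matrix (Fin (n + n)) (Fin (n + n)) ℂ) =
      (NormedSpace.exp (-Z)).map (evalC L w) *
        (((Matrix.GeneralLinearGroup.map (evalC L w) c)⁻¹ : GL (Fin (n + n)) ℂ) : Matrix (Fin (n + n)) (Fin (n + n)) ℂ) := by
  rw [map_mul, mul_inv_rev, Units.val_mul, ← map_inv, ← expGL_neg]
  rfl

include hdV0 hdW0 in
/-- **the archimedean height along `c · exp tX` IS the Gram height function at `exp(−tX)`**: for the frame data `(S, C_∞)` of a standard datum and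
`c ∈ C_∞`, `Φ_𝒦((c · exp tX, 1)) = gramHeightFun S c (exp(−tX))` (★ B1 `iwasawaHeight_archEmb_sq` and positivity of `Φ_𝒦`).
[cite: KudlaRallis1994, §1] [cite: Weil1964, Chap. I n° 8] -/
theorem iwasawaHeight_archEmb_expGL_eq (h𝒦 : 𝒦.IsStd)
    {Cinf : Subgroup (arch (Fp L) L (IsCMField.complexConj L) (n + n) (hermD L e dV hdV dW hdW))}
    {S : GL (Fin (n + n)) (mixedSpace L)}
    (hC : ∀ a : arch (Fp L) L (IsCMField.complexConj L) (n + n) (hermD L e dV hdV dW hdW),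
      a ∈ Cinf ↔ S⁻¹ * (a : GL (Fin (n + n)) (mixedSpace L)) * S ∈
        arch (Fp L) L (IsCMField.complexConj L) (n + n) (1 : Matrix (Fin (n + n)) (Fin (n + n)) L))
    (hKC : ∀ k : HA L e dV hdV dW hdW, k ∈ 𝒦.K →
      archPart (Fp L) L (IsCMField.complexConj L) (n + n) (hermD L e dV hdV dW hdW) k ∈ Cinf)
    (c : arch (Fp L) L (IsCMField.complexConj L) (n + n) (hermD L e dV hdV dW hdW))
    {Z : Matrix (Fin (n + n)) (Fin (n + n)) (mixedSpace L)} (hZ : Z ∈ archSkew (Fp L) L (IsCMField.complexConj L) (n + n) (hermD L e dV hdV dW hdW)) :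
    modDelta L e dV hdV dW hdW (𝒦.pPart (archEmb (Fp L) L (IsCMField.complexConj L) (n + n) (hermD L e dV hdV dW hdW)
        (c * ⟨expGL Z, expGL_mem_arch (hermD L e dV hdV dW hdW) hZ⟩))) =
      gramHeightFun L S (c : GL (Fin (n + n)) (mixedSpace L)) (NormedSpace.exp (-Z)) := by
  have hsq := iwasawaHeight_archEmb_sq L e dV hdV hdV0 dW hdW hdW0 𝒦 h𝒦 hC hKC (c * ⟨expGL Z, expGL_mem_arch (hermD L e dV hdV dW hdW) hZ⟩)
  have hpos := modDelta_pos L e dV hdV dW hdW (𝒦.pPart (archEmb (Fp L) L (IsCMField.complexConj L) (n + n) (hermD L e dV hdV dW hdW)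
    (c * ⟨expGL Z, expGL_mem_arch (hermD L e dV hdV dW hdW) hZ⟩)))
  rw [gramHeightFun_def, ← Real.sqrt_sq hpos.le, hsq]
  refine congrArg Real.sqrt (Finset.prod_congr rfl fun v _ => ?_)
  rw [show ((c * ⟨expGL Z, expGL_mem_arch (hermD L e dV hdV dW hdW) hZ⟩ :
      arch (Fp L) L (IsCMField.complexConj L) (n + n) (hermD L e dV hdV dW hdW)) : GL (Fin (n + n)) (mixedSpace L)) =
      (c : GL (Fin (n + n)) (mixedSpace L)) * expGL Z from rfl, coe_inv_map_mul_expGL]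

omit [NumberField L] [IsCMField L] in
/-- the `w`-component of `k Y k⁻¹`. [cite: Knapp2002, 0.§2] -/
theorem map_units_conj (k : GL (Fin (n + n)) (mixedSpace L)) (Y : Matrix (Fin (n + n)) (Fin (n + n)) (mixedSpace L))
    (w : {w : InfinitePlace L // w.IsComplex}) :
    ((k : Matrix (Fin (n + n)) (Fin (n + n)) (mixedSpace L)) * Y * ((k⁻¹ : GL (Fin (n + n)) (mixedSpace L)) : Matrix _ _ (mixedSpace L))).map
        (evalC L w) =
      ((Matrix.GeneralLinearGroup.map (evalC L w) k : GL (Fin (n + n)) ℂ) : Matrix (Fin (n + n)) (Fin (n + n)) ℂ) * Y.map (evalC L w) *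
        (((Matrix.GeneralLinearGroup.map (evalC L w) k)⁻¹ : GL (Fin (n + n)) ℂ) : Matrix (Fin (n + n)) (Fin (n + n)) ℂ) := by
  have h1 : (((k⁻¹ : GL (Fin (n + n)) (mixedSpace L)) : Matrix (Fin (n + n)) (Fin (n + n)) (mixedSpace L))).map (evalC L w) =
      ((Matrix.GeneralLinearGroup.map (evalC L w) k⁻¹ : GL (Fin (n + n)) ℂ) : Matrix (Fin (n + n)) (Fin (n + n)) ℂ) := rfl
  have h2 : ((k : GL (Fin (n + n)) (mixedSpace L)) : Matrix (Fin (n + n)) (Fin (n + n)) (mixedSpace L)).map (evalC L w) =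
      ((Matrix.GeneralLinearGroup.map (evalC L w) k : GL (Fin (n + n)) ℂ) : Matrix (Fin (n + n)) (Fin (n + n)) ℂ) := rfl
  rw [Matrix.map_mul, Matrix.map_mul, h1, h2, map_inv]

/-- **`gramHeightFun S (c k) Y = gramHeightFun S c (k Y k⁻¹)`** whenever `S⁻¹ k S ∈ U(1)` (★ B2 unitary invariance, place by place).
[cite: Weil1964, Chap. I n° 8] -/
theorem gramHeightFun_mul_right (S c k : GL (Fin (n + n)) (mixedSpace L))
    (hk : S⁻¹ * k * S ∈ arch (Fp L) L (IsCMField.complexConj L) (n + n) (1 : Matrix (Fin (n + n)) (Fin (n + n)) L))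
    (Y : Matrix (Fin (n + n)) (Fin (n + n)) (mixedSpace L)) :
    gramHeightFun L S (c * k) Y =
      gramHeightFun L S c ((k : Matrix (Fin (n + n)) (Fin (n + n)) (mixedSpace L)) * Y *
        ((k⁻¹ : GL (Fin (n + n)) (mixedSpace L)) : Matrix (Fin (n + n)) (Fin (n + n)) (mixedSpace L))) := by
  rw [gramHeightFun_def, gramHeightFun_def]
  refine congrArg Real.sqrt (Finset.prod_congr rfl fun v _ => ?_)
  -- the `w(v)`-components
  set f := Matrix.GeneralLinearGroup.map (n := Fin (n + n)) (evalC L (placeOver L v)) with hf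
  have hU := conjTranspose_mul_self_of_mem_arch_one L hk (placeOver L v) (complexConj_smul_infinitePlace L (placeOver L v).1)
  rw [map_mul, map_mul, map_inv] at hU
  have hTC : (((f S)⁻¹ : GL (Fin (n + n)) ℂ) : Matrix (Fin (n + n)) (Fin (n + n)) ℂ) * ((f k : GL (Fin (n + n)) ℂ) : Matrix _ _ ℂ) =
      (((f S)⁻¹ * f k * f S : GL (Fin (n + n)) ℂ) : Matrix (Fin (n + n)) (Fin (n + n)) ℂ) * (((f S)⁻¹ : GL (Fin (n + n)) ℂ) : Matrix _ _ ℂ) := by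
    rw [← Units.val_mul, ← Units.val_mul]
    congr 1
    group
  have h : siegelGram (((f S)⁻¹ : GL (Fin (n + n)) ℂ) : Matrix (Fin (n + n)) (Fin (n + n)) ℂ)
      (((k : Matrix (Fin (n + n)) (Fin (n + n)) (mixedSpace L)) * Y *
        ((k⁻¹ : GL (Fin (n + n)) (mixedSpace L)) : Matrix (Fin (n + n)) (Fin (n + n)) (mixedSpace L))).map (evalC L (placeOver L v)) *
        (((f c)⁻¹ : GL (Fin (n + n)) ℂ) : Matrix (Fin (n + n)) (Fin (n + n)) ℂ)) =
      siegelGram (((f S)⁻¹ : GL (Fin (n + n)) ℂ) : Matrix (Fin (n + n)) (Fin (n + n)) ℂ)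
        (Y.map (evalC L (placeOver L v)) * (((f (c * k))⁻¹ : GL (Fin (n + n)) ℂ) : Matrix (Fin (n + n)) (Fin (n + n)) ℂ)) := by
    rw [map_units_conj, map_mul, mul_inv_rev, Units.val_mul]
    have hassoc : ((f k : GL (Fin (n + n)) ℂ) : Matrix (Fin (n + n)) (Fin (n + n)) ℂ) * Y.map (evalC L (placeOver L v)) *
        (((f k)⁻¹ : GL (Fin (n + n)) ℂ) : Matrix (Fin (n + n)) (Fin (n + n)) ℂ) * (((f c)⁻¹ : GL (Fin (n + n)) ℂ) : Matrix _ _ ℂ) =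
        ((f k : GL (Fin (n + n)) ℂ) : Matrix (Fin (n + n)) (Fin (n + n)) ℂ) * (Y.map (evalC L (placeOver L v)) *
          ((((f k)⁻¹ : GL (Fin (n + n)) ℂ) : Matrix (Fin (n + n)) (Fin (n + n)) ℂ) * (((f c)⁻¹ : GL (Fin (n + n)) ℂ) : Matrix _ _ ℂ))) := by
      simp only [Matrix.mul_assoc]
    rw [hassoc, siegelGram_mul_left_of_unitary _ _ _ _ hU hTC]
  rw [h]

end Reduction

/-! ## 2. Differentiability of the Gram height function and the chain rule along `exp(−tX)` -/

section Calculus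

omit [IsCMField L] in
/-- `Y ↦ Y_w` (entrywise `evalC`) is differentiable (a continuous `ℝ`-linear map). [cite: Knapp2002, 0.§2] -/
theorem differentiable_map_evalC (w : {w : InfinitePlace L // w.IsComplex}) :
    Differentiable ℝ fun Y : Matrix (Fin (n + n)) (Fin (n + n)) (mixedSpace L) => Y.map (evalC L w) :=
  (LinearMap.toContinuousLinearMap
    ({ toFun := fun Y => Y.map (evalC L w)
       map_add' := fun A B => Matrix.map_add _ (map_add (evalC L w)) A B
       map_smul' := fun r A => by
         ext i j
         simp only [Matrix.map_apply, Matrix.smul_apply, RingHom.id_apply]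
         rfl } :
      Matrix (Fin (n + n)) (Fin (n + n)) (mixedSpace L) →ₗ[ℝ] Matrix (Fin (n + n)) (Fin (n + n)) ℂ)).differentiable

/-- **the Gram height function is differentiable at `Y = 1`** (★ B2 `contDiff_siegelGram_mul`; all Gram determinants are positive at `1`).
[cite: KudlaRallis1994, §1] [cite: Weil1964, Chap. I n° 8] -/
theorem differentiableAt_gramHeightFun (S c : GL (Fin (n + n)) (mixedSpace L)) : DifferentiableAt ℝ (gramHeightFun L S c) 1 := by
  -- notation-free abbreviations for the place data
  have hG : ∀ v : {v : InfinitePlace (Fp L) // v.IsReal}, DifferentiableAt ℝ (fun Y : Matrix (Fin (n + n)) (Fin (n + n)) (mixedSpace L) =>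
      (siegelGram (((Matrix.GeneralLinearGroup.map (evalC L (placeOver L v)) S)⁻¹ : GL (Fin (n + n)) ℂ) : Matrix (Fin (n + n)) (Fin (n + n)) ℂ)
        (Y.map (evalC L (placeOver L v)) *
          (((Matrix.GeneralLinearGroup.map (evalC L (placeOver L v)) c)⁻¹ : GL (Fin (n + n)) ℂ) : Matrix (Fin (n + n)) (Fin (n + n)) ℂ))).re) 1 := by
    intro v
    refine Complex.reCLM.differentiableAt.comp (1 : Matrix (Fin (n + n)) (Fin (n + n)) (mixedSpace L)) ?_
    exact (((contDiff_siegelGram_mul _ _).differentiable (by simp)).differentiableAt).comp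
      (1 : Matrix (Fin (n + n)) (Fin (n + n)) (mixedSpace L)) (differentiable_map_evalC L (placeOver L v)).differentiableAt
  have hGpos : ∀ v : {v : InfinitePlace (Fp L) // v.IsReal}, 0 <
      (siegelGram (((Matrix.GeneralLinearGroup.map (evalC L (placeOver L v)) S)⁻¹ : GL (Fin (n + n)) ℂ) : Matrix (Fin (n + n)) (Fin (n + n)) ℂ)
        ((1 : Matrix (Fin (n + n)) (Fin (n + n)) (mixedSpace L)).map (evalC L (placeOver L v)) *
          (((Matrix.GeneralLinearGroup.map (evalC L (placeOver L v)) c)⁻¹ : GL (Fin (n + n)) ℂ) : Matrix (Fin (n + n)) (Fin (n + n)) ℂ))).re := by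
    intro v
    rw [Matrix.map_one _ (map_zero _) (map_one _), Matrix.one_mul]
    obtain ⟨r, hr0, hr⟩ := siegelGram_pos
      (((Matrix.GeneralLinearGroup.map (evalC L (placeOver L v)) S)⁻¹ : GL (Fin (n + n)) ℂ) : Matrix (Fin (n + n)) (Fin (n + n)) ℂ)
      (((Matrix.GeneralLinearGroup.map (evalC L (placeOver L v)) c)⁻¹ : GL (Fin (n + n)) ℂ) : Matrix (Fin (n + n)) (Fin (n + n)) ℂ)
      (Units.isUnit _) (Units.isUnit _)
    rw [hr, Complex.ofReal_re]
    exact hr0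
  have hr : ∀ v : {v : InfinitePlace (Fp L) // v.IsReal}, 0 <
      (siegelGram (((Matrix.GeneralLinearGroup.map (evalC L (placeOver L v)) S)⁻¹ : GL (Fin (n + n)) ℂ) :
        Matrix (Fin (n + n)) (Fin (n + n)) ℂ) 1).re := by
    intro v
    obtain ⟨r, hr0, hr⟩ := siegelGram_pos
      (((Matrix.GeneralLinearGroup.map (evalC L (placeOver L v)) S)⁻¹ : GL (Fin (n + n)) ℂ) : Matrix (Fin (n + n)) (Fin (n + n)) ℂ) 1
      (Units.isUnit _) isUnit_one
    rw [hr, Complex.ofReal_re]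
    exact hr0
  -- the quotients and their product
  have hq : ∀ v : {v : InfinitePlace (Fp L) // v.IsReal}, DifferentiableAt ℝ (fun Y : Matrix (Fin (n + n)) (Fin (n + n)) (mixedSpace L) =>
      (siegelGram (((Matrix.GeneralLinearGroup.map (evalC L (placeOver L v)) S)⁻¹ : GL (Fin (n + n)) ℂ) : Matrix (Fin (n + n)) (Fin (n + n)) ℂ) 1).re /
      (siegelGram (((Matrix.GeneralLinearGroup.map (evalC L (placeOver L v)) S)⁻¹ : GL (Fin (n + n)) ℂ) : Matrix (Fin (n + n)) (Fin (n + n)) ℂ)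
        (Y.map (evalC L (placeOver L v)) *
          (((Matrix.GeneralLinearGroup.map (evalC L (placeOver L v)) c)⁻¹ : GL (Fin (n + n)) ℂ) : Matrix (Fin (n + n)) (Fin (n + n)) ℂ))).re) 1 := by
    intro v
    have h := ((hG v).inv (hGpos v).ne').const_mul
      ((siegelGram (((Matrix.GeneralLinearGroup.map (evalC L (placeOver L v)) S)⁻¹ : GL (Fin (n + n)) ℂ) :
        Matrix (Fin (n + n)) (Fin (n + n)) ℂ) 1).re)
    simpa only [div_eq_mul_inv, Pi.inv_apply] using h
  have hprod := HasFDerivAt.finsetProd (u := (Finset.univ : Finset {v : InfinitePlace (Fp L) // v.IsReal}))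
    (fun v _ => (hq v).hasFDerivAt)
  have hpos : (∏ v : {v : InfinitePlace (Fp L) // v.IsReal},
      (siegelGram (((Matrix.GeneralLinearGroup.map (evalC L (placeOver L v)) S)⁻¹ : GL (Fin (n + n)) ℂ) : Matrix (Fin (n + n)) (Fin (n + n)) ℂ) 1).re /
      (siegelGram (((Matrix.GeneralLinearGroup.map (evalC L (placeOver L v)) S)⁻¹ : GL (Fin (n + n)) ℂ) : Matrix (Fin (n + n)) (Fin (n + n)) ℂ)
        ((1 : Matrix (Fin (n + n)) (Fin (n + n)) (mixedSpace L)).map (evalC L (placeOver L v)) *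
          (((Matrix.GeneralLinearGroup.map (evalC L (placeOver L v)) c)⁻¹ : GL (Fin (n + n)) ℂ) : Matrix (Fin (n + n)) (Fin (n + n)) ℂ))).re) ≠ 0 :=
    (Finset.prod_pos fun v _ => div_pos (hr v) (hGpos v)).ne'
  have hs := hprod.differentiableAt.sqrt hpos
  exact hs

omit [IsCMField L] in
/-- the path `t ↦ exp(−tX)` in `M_{2n}(L ⊗ ℝ)` has derivative `−X` at `t = 0`. [cite: Knapp2002, 0.§2 Prop. 0.11] -/
theorem hasDerivAt_exp_neg_smul_zero (Z : Matrix (Fin (n + n)) (Fin (n + n)) (mixedSpace L)) :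
    HasDerivAt (fun t : ℝ => NormedSpace.exp (-(t • Z))) (-Z) 0 := by
  have h1 : HasDerivAt (fun u : ℝ => NormedSpace.exp (u • Z)) (NormedSpace.exp ((-0 : ℝ) • Z) * Z) (-0) :=
    hasDerivAt_exp_smul_const Z (-0)
  have h2 := h1.scomp (0 : ℝ) (hasDerivAt_neg (0 : ℝ))
  have h3 : ((fun u : ℝ => NormedSpace.exp (u • Z)) ∘ fun t : ℝ => -t) = fun t : ℝ => NormedSpace.exp (-(t • Z)) := by
    funext t
    simp only [Function.comp_apply, neg_smul]
  rw [h3] at h2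
  simpa only [neg_zero, zero_smul, NormedSpace.exp_zero, one_mul, neg_one_smul] using h2

/-- **chain rule along `exp(−tX)`**: `t ↦ gramHeightFun S c (exp(−tX))` has derivative `(D gramHeightFun_{S,c})(1)(−X)` at `0` — linear in `X`.
[cite: KudlaRallis1994, §1] [cite: Knapp2002, 0.§2 Prop. 0.11] -/
theorem hasDerivAt_gramHeightFun_exp (S c : GL (Fin (n + n)) (mixedSpace L)) (Z : Matrix (Fin (n + n)) (Fin (n + n)) (mixedSpace L)) :
    HasDerivAt (fun t : ℝ => gramHeightFun L S c (NormedSpace.exp (-(t • Z)))) ((fderiv ℝ (gramHeightFun L S c) 1) (-Z)) 0 :=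
  (differentiableAt_gramHeightFun L S c).hasFDerivAt.comp_hasDerivAt_of_eq (0 : ℝ) (hasDerivAt_exp_neg_smul_zero L Z)
    (by rw [zero_smul, neg_zero, NormedSpace.exp_zero])

end Calculus

end Summit.HodgeConjecture.HodgeConjecture.Cruxes.HLiu418.K2LiuIwasawaHeightGramFunction
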